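import Summits.Ventures.CertifiedManyBodySolver.Downfold.EmeryBoxesTl2201K26OneBandImage
import Summits.Ventures.CertifiedManyBodySolver.Downfold.EmeryBoxesTl2201K26OneBandImageNH125
import Summits.Ventures.CertifiedManyBodySolver.Downfold.EmeryBoxesTl2201K26ShapeBand
import Summits.Ventures.CertifiedManyBodySolver.Downfold.EmeryOneBandImageBand
import Summits.Ventures.CertifiedManyBodySolver.Downfold.EmeryScaleBoxTl2201NH125Pts
import Summits.Ventures.CertifiedManyBodySolver.Downfold.EmeryScaleBoxTl2201NH130Pts
import HarnessLib

/-!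
# THE ONE-BAND IMAGE OF Tl₂Ba₂CuO₆ (K) point box (one σ row) OVER A DOPING BAND — `the Tl-2201 (K) σ point (Δ, t_pd, t_pp, t_pp′) = (1.79, 1.27, 0.63, 0.15) eV` ([1.79, 1.79] × [1.27, 1.27] × [0.63, 0.63] × [0.15, 0.15] eV), x ∈ [0.25, 0.3] (ν ∈ [7/20, 3/8]; columns M34a (n_H 1.25) … M34a (n_H 1.30)): ONE typed statement «∀ member θ ∀ filling ν ∈ [ν₁, ν₂]»
# (INFL-3to1-B §B.98 THE DOPING CONTINUUM; kernel `EmeryOneBandImageBand`; router/ONE-BAND-IMAGE-BANDS.tsv)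

Venture CertifiedManyBodySolver, cell `pub/hubbard-downfold` (stage S1), seat hubbard-downfold-mod-4 (technique B, g43); namespace `Summit.Ventures.CertifiedManyBodySolver.Downfold.Emery`.
Everything PROVED (0 sorry; no new certificate). DEVICE: at fixed θ every image coordinate is monotone in the Fermi energy (t_node ↓, w_node ↓, w_face ↓, w_axis ↓ in ε; corpus levers) and
ε_F(θ; ν) is non-decreasing in ν, so each coordinate at ν ∈ [ν₁, ν₂] lies between its values at the END fillings, which the landed column capstones `tl2201Box_oneBandImage_nH125` (n_H = 1.25 (x = 0.25; hole-like)) and `tl2201Box_oneBandImage_nH130` (n_H = 1.30 (x = 0.30; electron-like)) window for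
every member; the box-wide Fermi-energy ceiling E_h = 8107/5000 (`scalePt_Tl2201NH125_TP_br`) carries the regime margins; t′/t by the true-corner band device `EmeryBoxesTl2201K26ShapeBand`.
WHAT THIS IS NOT: a statement about Tl₂Ba₂CuO₆ (K) point box (one σ row) — the typed box and its tags are SCREENING-GRADE; `U = 0` one-body kinematics of the σ model (rigid band); no U number; not a phase word.

| box | doping band | t (eV) | t′/t | w_node | 4th / 5th coordinate |
|---|---|---|---|---|---|
| the Tl-2201 (K) σ point (Δ, t_pd, t_pp, t_pp′) = (1.79, 1.27, 0.63, 0.15) eV | x ∈ [0.25, 0.3] (ν ∈ [7/20, 3/8]; columns M34a (n_H 1.25) … M34a (n_H 1.30)) | [0.5566, 0.5718] | [-0.2864, -0.2860] | [0.6289, 0.6336] | every Fermi-surface Bloch state's Cu-d weight `≤ 0.7145` (universal axis-corner ceiling; no uniform topology claimed) |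

Sources: three-band model [HybertsenSchluterChristensen1989, Eq. (1)]; [AndersenEtAl1995, §6]; [folklore] algebra.
-/

noncomputable section

namespace Summit.Ventures.CertifiedManyBodySolver.Downfold.Emery

open Real Set

/-- **THE ONE-BAND IMAGE OF `emeryBoxTl2201K26 (point)` — the Tl-2201 (K) σ point (Δ, t_pd, t_pp, t_pp′) = (1.79, 1.27, 0.63, 0.15) eV — OVER THE DOPING BAND x ∈ [0.25, 0.3] (ν ∈ [7/20, 3/8]; columns M34a (n_H 1.25) … M34a (n_H 1.30))**: for EVERY member θ AND EVERY filling ν of the band: `t ∈ [0.5566, 0.5718]` eV, `t′/t ∈ [-0.2864, -0.2860]`, `w_node ∈ [0.6289, 0.6336]`, every Fermi-surface Bloch state's Cu-d weight `≤ 0.7145` (universal axis-corner ceiling; no uniform topology claimed). Pure composition: kernel `EmeryOneBandImageBand` (filling levers) + the two END-column capstones `tl2201Box_oneBandImage_nH125` / `tl2201Box_oneBandImage_nH130` + the t′/t true-corner band `tl2201K26Box_fsRatio_band`. [folklore] -/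
theorem tl2201Box_oneBandImage_band_nH125_nH130 {Δ a b c ν : ℝ} (hΔ : Δ ∈ Icc ((179 : ℝ) / 100) ((179 : ℝ) / 100)) (ha : a ∈ Icc ((127 : ℝ) / 100) ((127 : ℝ) / 100)) (hb : b ∈ Icc ((63 : ℝ) / 100) ((63 : ℝ) / 100)) (hc : c ∈ Icc ((3 : ℝ) / 20) ((3 : ℝ) / 20)) (hν : ν ∈ Icc ((7 : ℝ) / 20) ((3 : ℝ) / 8)) :
    scaleT Δ a b c (xNode Δ a b c (fermiEnergyOf Δ a b c ν)) (xNode Δ a b c (fermiEnergyOf Δ a b c ν)) (fermiEnergyOf Δ a b c ν) ∈ Icc (5566/10000 : ℝ) (5718/10000 : ℝ) ∧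
      fsRatio Δ a b c (fermiEnergyOf Δ a b c ν) ∈ Icc ((-179 : ℝ) / 625) ((-143 : ℝ) / 500) ∧
      dWeightNode Δ a b c (fermiEnergyOf Δ a b c ν) ∈ Icc ((6289 : ℝ) / 10000) ((396 : ℝ) / 625) ∧
      (∀ x y : ℝ, x ∈ Icc (0 : ℝ) 1 → y ∈ Icc (0 : ℝ) 1 → charCubic Δ a b c x y (fermiEnergyOf Δ a b c ν) = 0 →
        dWeight Δ a b c x y (fermiEnergyOf Δ a b c ν) ≤ ((1429 : ℝ) / 2000)) := by
  have hΔ0 : 0 < Δ := lt_of_lt_of_le (by norm_num) hΔ.1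
  have ha0 : 0 < a := lt_of_lt_of_le (by norm_num) ha.1
  have hc0 : 0 ≤ c := le_trans (by norm_num) hc.1
  have hcb : c ≤ b := hc.2.trans (le_trans (by norm_num) hb.1)
  have hb0 : 0 ≤ b := hc0.trans hcb
  have hΔw : Δ ∈ Icc ((179 : ℝ) / 100) ((179 : ℝ) / 100) := ⟨le_trans (by norm_num) hΔ.1, le_trans hΔ.2 (by norm_num)⟩
  -- the two END columns (landed capstones)
  have h2 := tl2201Box_oneBandImage_nH125 hΔ ha hb hc
  have h1 := tl2201Box_oneBandImage_nH130 hΔ ha hb hc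
  -- the box-wide Fermi-energy ceiling E_h = 8107/5000 (top corner (Δ₁, a₂, b₂, c₁) of the whole box at ν = 3/8, `scalePt_Tl2201NH125_TP_br`)
  have hT := (fermiEnergyOf_of_pointBracketCheck scalePt_Tl2201NH125_TP_br (by norm_num) (by norm_num) (by norm_num) (ν := (3/8 : ℝ)) (by push_cast; exact ⟨le_rfl, le_rfl⟩)).2
  push_cast at hT
  have hbox := fermiEnergyOf_mem_Icc_of_mem_box' (ν := ((3 : ℝ) / 8)) (by norm_num) (by norm_num) (by norm_num) (by norm_num) hΔw ha hb hc (by norm_num) (by norm_num)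
  have htop : ((3 : ℝ) / 8) = (3/8 : ℝ) := by norm_num
  have hEh0 : fermiEnergyOf Δ a b c ((3 : ℝ) / 8) ≤ ((8107 : ℝ) / 5000) := by
    refine hbox.2.trans ?_
    rw [htop]; exact hT.2
  have hEh : fermiEnergyOf Δ a b c ((3 : ℝ) / 8) ≤ ((8107 : ℝ) / 5000) :=
    fermiEnergyOf_le_of_band (ν₂ := ((3 : ℝ) / 8)) hΔ0 ha0.ne' hc0 hb0 (by norm_num) (by norm_num) (by norm_num) hEh0
  have ha2 : ((127 : ℝ) / 100) ^ 2 ≤ a ^ 2 := pow_le_pow_left₀ (by norm_num) ha.1 2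
  have hm : c * (((8107 : ℝ) / 5000)) < a ^ 2 := by nlinarith [hc.2]
  have hq : b * Δ < 4 * a ^ 2 := by nlinarith [mul_le_mul hb.2 hΔw.2 hΔ0.le (by norm_num : (0 : ℝ) ≤ ((63 : ℝ) / 100))]
  -- the universal axis-corner ceiling over the band: E_l from the nH130 floor bracket at ν₁, E_h from the nH125 top bracket at ν₂
  have hF := (fermiEnergyOf_of_pointBracketCheck scalePt_Tl2201NH130_FL_br (by norm_num) (by norm_num) (by norm_num) (ν := (7/20 : ℝ)) (by push_cast; exact ⟨le_rfl, le_rfl⟩)).2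
  have hT' := (fermiEnergyOf_of_pointBracketCheck scalePt_Tl2201NH125_TP_br (by norm_num) (by norm_num) (by norm_num) (ν := (3/8 : ℝ)) (by push_cast; exact ⟨le_rfl, le_rfl⟩)).2
  push_cast at hF hT'
  refine ⟨?_, tl2201K26Box_fsRatio_band hΔ ha hb hc hν, ?_, fun x y hx hy hP => ?_⟩
  · exact scaleT_node_fermiEnergyOf_mem_Icc_of_band hΔ0 ha0.ne' hc0 hcb (by norm_num) hν (by norm_num) hEh hm hq h2.1.1 h1.1.2
  · exact dWeightNode_fermiEnergyOf_mem_Icc_of_band hΔ0 ha0.ne' hc0 hcb (by norm_num) hν (by norm_num) h2.2.2.1.1 h1.2.2.1.2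
  · exact dWeight_le_of_mem_box_axis'_band (El := ((15773 : ℝ) / 10000)) (Eh := ((8107 : ℝ) / 5000)) (by norm_num) (by norm_num) (by norm_num) (by norm_num) (by norm_num) hΔ ha hb hc (by norm_num) hν (by norm_num)
      (by norm_num) hF.1 hT'.2 (by norm_num) (by norm_num) (by norm_num) (by norm_num [dWeightAxisCF]) hx hy hP

end Summit.Ventures.CertifiedManyBodySolver.Downfold.Emery
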